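import Summits.Ventures.PercRepro.StarGadgetPurePairG

/-!
# `G ≥ 0` at `s ≥ 1, n ≥ 1, p = q = r = 0` (nodes n27, n28, n26: the split `s = 1 / s ≥ 2`)

One module of the exact certificate tree for `G` (data/mine-3/g20/single-p2.json, key `P[xc|xc]|cx=1`; one lemma per node:
half-space domination certificates, finite boxes, case splits `x = 0 / x ≥ 1`). The definition of `G` is in `StarGadgetPurePairG`;
the theorem `G_nonneg` is in `StarGadgetPurePairNonneg`. A factor `(0:ℤ)^x` is the indicator `[x = 0]`.
-/

namespace PercRepro.StarGadget

/-- Half-space lemma of node n27 of the certificate tree (parent `G_n27`: `0 ≤ G 0 0 0 1 (n + 1)`), direction `n` (the half-space `n ≥ 1` of the parent's variable): `0 ≤ G 0 0 0 1 (n + 2)` — the exact domination certificate of record (data/mine-3/g20/single-p2.json, key `P[xc|xc]|cx=1`, node n27, direction n, N = 1): coordinatewise base monotonicity of the dominated monomials, positivity, `linarith`. -/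
theorem G_n27_dn (n : ℕ) : 0 ≤ G 0 0 0 (0 + 1) (n + 1 + 1) := by
  have h0 : (16:ℤ)^n ≤ (32:ℤ)^n := by
    have := show (16:ℤ)^n ≤ (32:ℤ)^n by
      gcongr
      all_goals norm_num
    simpa using this
  have h1 : (0:ℤ) ≤ (32:ℤ)^n := by positivity
  unfold G
  simp only [pow_add]
  norm_num
  linarith [h0, h1]

/-- Node n27 of the certificate tree (half-space node): `0 ≤ G 0 0 0 1 (n + 1)` — the half-spaces `n ≥ 1` (direction lemmas `G_n27_d*`) and the remaining single point by `norm_num [G]`. -/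
theorem G_n27 (n : ℕ) : 0 ≤ G 0 0 0 (0 + 1) (n + 1) := by
  by_cases hn : 1 ≤ n
  · obtain ⟨n, rfl⟩ := Nat.exists_eq_add_of_le' hn
    exact G_n27_dn n
  push Not at hn
  obtain rfl : n = 0 := by omega
  norm_num [G]

/-- Half-space lemma of node n28 of the certificate tree (parent `G_n28`: `0 ≤ G 0 0 0 (s + 2) (n + 1)`), direction `s` (the half-space `s ≥ 1` of the parent's variable): `0 ≤ G 0 0 0 (s + 3) (n + 1)` — the exact domination certificate of record (data/mine-3/g20/single-p2.json, key `P[xc|xc]|cx=1`, node n28, direction s, N = 1): coordinatewise base monotonicity of the dominated monomials, positivity, `linarith`. -/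
theorem G_n28_ds (s n : ℕ) : 0 ≤ G 0 0 0 (s + 1 + 1 + 1) (n + 1) := by
  have h0 : (5:ℤ)^s * 16^n ≤ (6:ℤ)^s * 32^n := by
    have := show (5:ℤ)^s * 16^n ≤ (6:ℤ)^s * 32^n by
      gcongr
      all_goals norm_num
    simpa using this
  have h1 : (5:ℤ)^s * 16^n ≤ (6:ℤ)^s * 16^n := by
    have := show (5:ℤ)^s * 16^n ≤ (6:ℤ)^s * 16^n by
      gcongr
      all_goals norm_num
    simpa using this
  have h2 : (32:ℤ)^n ≤ (2:ℤ)^s * 32^n := by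
    have := show (1:ℤ)^s * 32^n ≤ (2:ℤ)^s * 32^n by
      gcongr
      all_goals norm_num
    simpa using this
  have h3 : (3:ℤ)^s * 32^n ≤ (6:ℤ)^s * 32^n := by
    have := show (3:ℤ)^s * 32^n ≤ (6:ℤ)^s * 32^n by
      gcongr
      all_goals norm_num
    simpa using this
  have h4 : (3:ℤ)^s * 16^n ≤ (4:ℤ)^s * 16^n := by
    have := show (3:ℤ)^s * 16^n ≤ (4:ℤ)^s * 16^n by
      gcongr
      all_goals norm_num
    simpa using this
  have h5 : (0:ℤ) ≤ (16:ℤ)^n := by positivity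
  have h6 : (0:ℤ) ≤ (2:ℤ)^s * 16^n := by positivity
  have h7 : (0:ℤ) ≤ (2:ℤ)^s * 32^n := by positivity
  have h8 : (0:ℤ) ≤ (6:ℤ)^s * 32^n := by positivity
  have h9 : (0:ℤ) ≤ (4:ℤ)^s * 16^n := by positivity
  have h10 : (0:ℤ) ≤ (6:ℤ)^s * 16^n := by positivity
  unfold G
  simp only [pow_add]
  norm_num
  linarith [h0, h1, h2, h3, h4, h5, h6, h7, h8, h9, h10]

/-- Half-space lemma of node n28 of the certificate tree (parent `G_n28`: `0 ≤ G 0 0 0 (s + 2) (n + 1)`), direction `n` (the half-space `n ≥ 1` of the parent's variable): `0 ≤ G 0 0 0 (s + 2) (n + 2)` — the exact domination certificate of record (data/mine-3/g20/single-p2.json, key `P[xc|xc]|cx=1`, node n28, direction n, N = 1): coordinatewise base monotonicity of the dominated monomials, positivity, `linarith`. -/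
theorem G_n28_dn (s n : ℕ) : 0 ≤ G 0 0 0 (s + 1 + 1) (n + 1 + 1) := by
  have h0 : (5:ℤ)^s * 16^n ≤ (6:ℤ)^s * 32^n := by
    have := show (5:ℤ)^s * 16^n ≤ (6:ℤ)^s * 32^n by
      gcongr
      all_goals norm_num
    simpa using this
  have h1 : (5:ℤ)^s * 16^n ≤ (6:ℤ)^s * 16^n := by
    have := show (5:ℤ)^s * 16^n ≤ (6:ℤ)^s * 16^n by
      gcongr
      all_goals norm_num
    simpa using this
  have h2 : (32:ℤ)^n ≤ (2:ℤ)^s * 32^n := by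
    have := show (1:ℤ)^s * 32^n ≤ (2:ℤ)^s * 32^n by
      gcongr
      all_goals norm_num
    simpa using this
  have h3 : (3:ℤ)^s * 32^n ≤ (6:ℤ)^s * 32^n := by
    have := show (3:ℤ)^s * 32^n ≤ (6:ℤ)^s * 32^n by
      gcongr
      all_goals norm_num
    simpa using this
  have h4 : (3:ℤ)^s * 16^n ≤ (4:ℤ)^s * 16^n := by
    have := show (3:ℤ)^s * 16^n ≤ (4:ℤ)^s * 16^n by
      gcongr
      all_goals norm_num
    simpa using this
  have h5 : (0:ℤ) ≤ (16:ℤ)^n := by positivity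
  have h6 : (0:ℤ) ≤ (2:ℤ)^s * 16^n := by positivity
  have h7 : (0:ℤ) ≤ (2:ℤ)^s * 32^n := by positivity
  have h8 : (0:ℤ) ≤ (6:ℤ)^s * 32^n := by positivity
  have h9 : (0:ℤ) ≤ (4:ℤ)^s * 16^n := by positivity
  have h10 : (0:ℤ) ≤ (6:ℤ)^s * 16^n := by positivity
  unfold G
  simp only [pow_add]
  norm_num
  linarith [h0, h1, h2, h3, h4, h5, h6, h7, h8, h9, h10]

/-- Node n28 of the certificate tree (half-space node): `0 ≤ G 0 0 0 (s + 2) (n + 1)` — the half-spaces `s ≥ 1`, `n ≥ 1` (direction lemmas `G_n28_d*`) and the remaining single point by `norm_num [G]`. -/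
theorem G_n28 (s n : ℕ) : 0 ≤ G 0 0 0 (s + 1 + 1) (n + 1) := by
  by_cases hs : 1 ≤ s
  · obtain ⟨s, rfl⟩ := Nat.exists_eq_add_of_le' hs
    exact G_n28_ds s n
  by_cases hn : 1 ≤ n
  · obtain ⟨n, rfl⟩ := Nat.exists_eq_add_of_le' hn
    exact G_n28_dn s n
  push Not at hs hn
  obtain rfl : s = 0 := by omega
  obtain rfl : n = 0 := by omega
  norm_num [G]

/-- Node n26 of the certificate tree (case split on `s`): `0 ≤ G 0 0 0 (s + 1) (n + 1)` — `s = 0` by `G_n27`, `s ≥ 1` by `G_n28`. -/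
theorem G_n26 (s n : ℕ) : 0 ≤ G 0 0 0 (s + 1) (n + 1) := by
  rcases Nat.eq_zero_or_pos s with h | h
  · subst h
    exact G_n27 n
  · obtain ⟨s, rfl⟩ := Nat.exists_eq_add_of_le' h
    exact G_n28 s n

end PercRepro.StarGadget
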